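import Summits.CriticalPhenomena.CardyFormulaZ2.Theses.CardyBoundaryCoulombGas
import Literature.Probability.LatticeModels.RowStatePlanar

/-!
# Uniqueness of the escape and relaxation moduli (line `two-cluster-rate-is-stationary-gap`, crux `StripClusterRates`)

The escape modulus of width `n` (the largest `‖μ‖` over eigenpairs of the MARKED block of
`planarTransfer (Finset.Icc 0 n)`) and the relaxation modulus (the largest `‖μ‖` over eigenpairs `μ ≠ 1` of the
UNMARKED block) are unique real numbers: each candidate dominates the other's witnessing eigenpair. These two
one-liners are the glue by which the Bethe identification stubs (`stub_escapeIsBethe`, `stub_relaxIsBethe`) pin the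
sequences `r n`, `s n` of `KacGapAsymptotics`. Stated over tree vocabulary (inlined predicates), no definitions.
-/

noncomputable section

namespace Summit.CriticalPhenomena.CardyFormulaZ2.Cruxes.StripClusterRates.TwoClusterRateIsStationaryGap

open scoped BigOperators Classical
open Literature.Probability.Percolation Literature.Probability.LatticeModels

/-- **The escape modulus is unique**: two reals that are both "the largest modulus of a marked eigenpair" of
`planarTransfer (Finset.Icc 0 n)` coincide. [folklore] -/
theorem bi_escapeModulus_unique : ∀ (n : ℕ) (r r' : ℝ),
    ((∃ (μ : ℂ) (v : PlanarRowState (Finset.Icc (0 : ℤ) n) → ℂ),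
          (v ≠ 0 ∧ (∀ p, (∀ x, ¬ p.1.JoinedToStar x) → v p = 0) ∧
            ∀ p, (∃ x, p.1.JoinedToStar x) →
              ∑ q, (planarTransfer (Finset.Icc (0 : ℤ) n) p q : ℂ) * v q = μ * v p) ∧
          ‖μ‖ = r) ∧
        ∀ (μ : ℂ) (v : PlanarRowState (Finset.Icc (0 : ℤ) n) → ℂ),
          (v ≠ 0 ∧ (∀ p, (∀ x, ¬ p.1.JoinedToStar x) → v p = 0) ∧
            ∀ p, (∃ x, p.1.JoinedToStar x) →
              ∑ q, (planarTransfer (Finset.Icc (0 : ℤ) n) p q : ℂ) * v q = μ * v p) →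
          ‖μ‖ ≤ r) →
    ((∃ (μ : ℂ) (v : PlanarRowState (Finset.Icc (0 : ℤ) n) → ℂ),
          (v ≠ 0 ∧ (∀ p, (∀ x, ¬ p.1.JoinedToStar x) → v p = 0) ∧
            ∀ p, (∃ x, p.1.JoinedToStar x) →
              ∑ q, (planarTransfer (Finset.Icc (0 : ℤ) n) p q : ℂ) * v q = μ * v p) ∧
          ‖μ‖ = r') ∧
        ∀ (μ : ℂ) (v : PlanarRowState (Finset.Icc (0 : ℤ) n) → ℂ),
          (v ≠ 0 ∧ (∀ p, (∀ x, ¬ p.1.JoinedToStar x) → v p = 0) ∧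
            ∀ p, (∃ x, p.1.JoinedToStar x) →
              ∑ q, (planarTransfer (Finset.Icc (0 : ℤ) n) p q : ℂ) * v q = μ * v p) →
          ‖μ‖ ≤ r') →
    r = r' := by
  intro n r r' hr hr'
  obtain ⟨⟨μ, v, hμ, hμr⟩, hdom⟩ := hr
  obtain ⟨⟨μ', v', hμ', hμr'⟩, hdom'⟩ := hr'
  exact le_antisymm (hμr ▸ hdom' μ v hμ) (hμr' ▸ hdom μ' v' hμ')

/-- **The relaxation modulus is unique**: two reals that are both "the largest modulus of an unmarked eigenpair
with eigenvalue `≠ 1`" of `planarTransfer (Finset.Icc 0 n)` coincide. [folklore] -/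
theorem bi_relaxationModulus_unique : ∀ (n : ℕ) (s s' : ℝ),
    ((∃ (μ : ℂ) (v : PlanarRowState (Finset.Icc (0 : ℤ) n) → ℂ),
          (v ≠ 0 ∧ (∀ p, (∃ x, p.1.JoinedToStar x) → v p = 0) ∧
            ∀ p, (∀ x, ¬ p.1.JoinedToStar x) →
              ∑ q, (planarTransfer (Finset.Icc (0 : ℤ) n) p q : ℂ) * v q = μ * v p) ∧
          μ ≠ 1 ∧ ‖μ‖ = s) ∧
        ∀ (μ : ℂ) (v : PlanarRowState (Finset.Icc (0 : ℤ) n) → ℂ),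
          (v ≠ 0 ∧ (∀ p, (∃ x, p.1.JoinedToStar x) → v p = 0) ∧
            ∀ p, (∀ x, ¬ p.1.JoinedToStar x) →
              ∑ q, (planarTransfer (Finset.Icc (0 : ℤ) n) p q : ℂ) * v q = μ * v p) →
          μ ≠ 1 → ‖μ‖ ≤ s) →
    ((∃ (μ : ℂ) (v : PlanarRowState (Finset.Icc (0 : ℤ) n) → ℂ),
          (v ≠ 0 ∧ (∀ p, (∃ x, p.1.JoinedToStar x) → v p = 0) ∧
            ∀ p, (∀ x, ¬ p.1.JoinedToStar x) →
              ∑ q, (planarTransfer (Finset.Icc (0 : ℤ) n) p q : ℂ) * v q = μ * v p) ∧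
          μ ≠ 1 ∧ ‖μ‖ = s') ∧
        ∀ (μ : ℂ) (v : PlanarRowState (Finset.Icc (0 : ℤ) n) → ℂ),
          (v ≠ 0 ∧ (∀ p, (∃ x, p.1.JoinedToStar x) → v p = 0) ∧
            ∀ p, (∀ x, ¬ p.1.JoinedToStar x) →
              ∑ q, (planarTransfer (Finset.Icc (0 : ℤ) n) p q : ℂ) * v q = μ * v p) →
          μ ≠ 1 → ‖μ‖ ≤ s') →
    s = s' := by
  intro n s s' hs hs'
  obtain ⟨⟨μ, v, hμ, hμ1, hμs⟩, hdom⟩ := hs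
  obtain ⟨⟨μ', v', hμ', hμ1', hμs'⟩, hdom'⟩ := hs'
  exact le_antisymm (hμs ▸ hdom' μ v hμ hμ1) (hμs' ▸ hdom μ' v' hμ' hμ1')

end Summit.CriticalPhenomena.CardyFormulaZ2.Cruxes.StripClusterRates.TwoClusterRateIsStationaryGap

end
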